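import Mathlib
import HarnessLib
import HarnessLib.Audit
import Summits.QuantumAdvantage.Statement
import Literature.Computability.Cryptography.ClassBQP
import Literature.Computability.Complexity.BoolEncodings
import HarnessLib.Audit.Status.Attr

/-!
Route: CentralFactorial

DORMANT since 2026-08-26T14:17:00Z (reconciler: no traction for 6.7 d (last activity item-proof-filed at 2026-08-19T20:56:37Z); parked, not closed — `ledger route dormant route-QuantumAdvantage-CentralFactorial --off` to reactivate) — unstaffed, not closed; items shared with open routes are served there. `ledger route dormant <id> --off` reactivates.

# Route CentralFactorial — central factorial mod p — quartic Gauss-sum sign in BQP, Pell unit,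
GRH-free class bit

X (hypothesis-type, realises card central-factorial-three-faces): the CENTRAL-FACTORIAL LANGUAGE
L_W := { p : p prime, p ≡ 1 (mod 4), 2·(((p−1)/2)! mod p) < p } is not in BPP. By Wilson, β_p :=
((p−1)/2)! mod p is a
square root of −1 mod p, so L_W records the one bit Wilson's theorem leaves open (the two roots are
classical: Schoof /
random non-residue). It suffices to show X because L_W ∈ BQP is a THEOREM-TARGET: Matthews' 1979
evaluation of the quartic
Gauss sum g(χ_π) = ε·√((−1)^{(p−1)/4} π √p), ε = −β·χ_π(2i)·(2|b|/|a|) with β = β_p read in ℤ[i]/π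
(crux MatthewsQuarticSign,
the needed printed fact, filed as the route's own first crux and verified numerically for every p <
3000), makes β_p the
eigenphase of van Dam–Seroussi's unitary χ²∘F_p on |χ_π⟩ (two antipodal candidates, one Hadamard
test: crux
WilsonMemBQPOfMatthews); then ⟨L_W, ·, X⟩ witnesses ∃ L ∈ BQP, L ∉ BPP. Second face (crux
UnitResidueQSolvable): the
fundamental unit ε_p = (t+u√p)/2 reduced at the ramified prime, t mod p, is quantum polynomial-time
WITHOUT GRH (Hallgren's
regulator + compact representations), and Kiselev–Chowla's congruence 2β_p ≡ (−1)^{(h+1)/2} t (mod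
p) turns the pair of
faces into a GRH-free quantum algorithm for h(ℚ(√p)) mod 4 (support ClassBitOfFaces).
Lean: `Computability.encodingNatBool.toLanguage {p : ℕ | p.Prime ∧ p % 4 = 1 ∧ 2 * (Nat.factorial
((p - 1) / 2) % p) < p} ∉ Literature.Computability.Complexity.BPP`

## Assembly
Pure logic (sorry-free in Sketch.lean and glue.lean, axioms propext/choice/Quot.sound only):
WilsonMemBQPOfMatthews applied to
MatthewsQuarticSign gives L_W ∈ BQP; with X = WilsonThesis (L_W ∉ BPP) the pair ⟨L_W, ·, ·⟩ inhabits
QuantumAdvantage = Literature.QuantumAdvantage.BQPNotSubsetBPP = ∃ L, L ∈ BQP ∧ L ∉ BPP. The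
deciding theorem is
`closes (h₁ : MatthewsQuarticSign) (h₂ : WilsonMemBQPOfMatthews) (h₃ : WilsonThesis) :
QuantumAdvantage := ⟨_, h₂ h₁, h₃⟩`.

UNDER FLOOR: fewer than 2 cruxes remain after retriage (legacy route; D-0019).

Rationale: WHY THIS LINE. Every witness route to S is conditional on a classical-hardness hypothesis; this one
trades factoring for the oldest
"not faster than √p" computation in arithmetic — n! mod p (Strassen; BostanGaudrySchost2007
p^{1/2+o(1)}; CostaGerbiczHarvey2014
polylog only amortised over p ≤ N) — and earns a theorem-grade quantum half from algebraic number
theory rather than from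
periodicity: Matthews1979Quartic (IrelandRosen1990 p. 138, BerndtEvans1981 §4.2) identifies the
central-factorial bit with
the SIGN of the quartic Gauss sum, which vanDamSeroussi2002 (Algorithm 1, Thm 1) reads as an
eigenphase; Kiselev 1948 /
Chowla1961 (JacobsonWilliams2008 §9.2) identify the same bit with the fundamental unit at p twisted
by h mod 4, which
Hallgren2007 + BuchmannThielWilliams1995 read GRH-free. Imported areas: quartic reciprocity / Gauss
sums (IR Ch. 9), real
quadratic units and Dirichlet's class number formula (AnkenyArtinChowla1952, Mordell1961), quantum
phase estimation and
period finding over ℝ. What it does that prior routes do not: KummerSector (order 3, BROKEN) has no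
factorial/unit face and its
rationale files Matthews-quartic and Chowla as "calibration"; here order 4 is the point —
archimedean sector = Gauss factorial =
Pell unit — so vDS §8's second question ("which problems reduce to Gauss sum estimation that do not
reduce to factoring or
DLOG?") gets a 200-year-old answer, and the class bit of a REAL quadratic field becomes
quantum-computable with no GRH
(DarkClassGroups treats imaginary fields under a no-Siegel-zero hypothesis; Shor needs FACT ∉ BPP).

RANKED CRUXES. #0 WilsonThesis (target) — X — the central-factorial language L_W = {p prime ≡ 1 (4)
: 2·(((p−1)/2)! mod p) < p} is not in BPP (hypothesis-type; its negation WilsonClassical is filed as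
the kill). (why it might fail: X may simply be false: a polylog p-adic evaluation of Γ_p(1/2) mod p,
a quartic theta-reciprocity descent à la Hiary, or a regulator-free route to ε_p mod p puts L_W in
P; today β_p costs p^{1/2+o(1)} (BGS), or L(1/2) via ℚ(√p) under GRH.) [vanDamSeroussi2002,
BostanGaudrySchost2007, CostaGerbiczHarvey2014, CrandallDilcherPomerance1997,
VanderpoortenTerieleWilliams2000]
#2 MatthewsQuarticSign (crux) — THE NEEDED PRINTED FACT (Matthews 1979, conjectured in part by
Loxton; IR p. 138 form). p ≡ 1 (4) prime, p = a² + b² with π = a + bi PRIMARY (a ≡ 1, b ≡ 0 (4) or a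
≡ 3, b ≡ 2 (4); IR Lemma 6 p. 121), r := −a·b⁻¹ mod p (the residue of i mod π), χ_π(x) := i^j when
x^{(p−1)/4} ≡ r^j (mod p), β := i if ((p−1)/2)! ≡ r (mod p) and −i otherwise. Then Σ_{x<p} χ_π(x)
e^{2πix/p} = −β·χ_π(2i)·(2|b| / |a|)·√((−1)^{(p−1)/4}(a+bi)√p) with the principal square root
(positive real part) and the Jacobi symbol; here χ_π(2i) = χ(2r). Card item K2's named fact;
verified numerically this session for all 422 pairs (p, π), p < 3000 (compute/matthews_check.py;
note IR Prop. 9.10.1 gives g² = −(−1)^{(p−1)/4}√p·π, so ε ∈ {±i}: the p. 138 display "g² =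
(−1)^{(p−1)/4}π√p" drops a sign but the final formula is right as printed). [difficulty: XL] (why it
might fail: True theorem (Matthews1979Quartic, proof via modular/elliptic functions — unproved in
Lean, deep); as TRANSCRIBED it can only fail through conventions (primary normalisation, χ_π vs its
conjugate, branch of √, Jacobi symbol at negative a) — all pinned by the p < 3000 numerical check.)
[Matthews1979Quartic, IrelandRosen1990, BerndtEvans1981, Loxton1978 doi:10.1515/crll.1978.297.153]
#3 WilsonMemBQPOfMatthews (crux) — Matthews' sign theorem ⟹ L_W ∈ BQP (tree model: P-uniform
oracle-free Clifford+T family, one-wire measurement, error ≤ 1/3). Algorithm on input w: reject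
non-codewords; p := decode w; PRIMES ∈ P and p ≡ 1 (4) else reject; r := a square root of −1 mod p
(random non-residue to the power (p−1)/4, or Schoof1985 deterministically), π = a + bi := gcd(p, r −
i) in ℤ[i] made primary (Cornacchia/Euclid), so r ≡ −a/b; classical symbols χ_π(2i) = χ(2r) (one
modular exponentiation compared with {1, r, −1, −r}) and (2|b|/|a|); quantum (vanDamSeroussi2002
Alg. 1 + Thm 1): prepare |χ_π⟩ = (p−1)^{−1/2} Σ_{x≠0} χ_π(x)|x⟩ by phase kickback of j(x) ∈ ℤ/4 (no
discrete log at fixed order), apply an approximate F_p then the diagonal Legendre phase |y⟩ ↦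
χ_π²(y)|y⟩: |χ_π⟩ is an eigenvector with eigenvalue g(χ_π)/√p, whose two candidates ±i·(classical
unit complex number) are ANTIPODAL, so O(1) Hadamard tests decide ε with error ≤ 1/10; β :=
−ε/(χ_π(2i)(2|b|/|a|)) ∈ {±i}; β_p := r if β = i else p − r; accept iff 2β_p < p. Card item K2.
[deps: MatthewsQuarticSign] [difficulty: L] (why it might fail: Safe given the antecedent; may fail
AS TYPED: needs a uniform APPROXIMATE F_p (p not a power of 2; Kitaev1995 §5, HalesHallgren2000)
with operator-norm error inside the 1/3 budget and classical pre/post-processing folded into ONE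
uniform family — the layer KsMemBQP also lacks.) [vanDamSeroussi2002, Kitaev1995, HalesHallgren2000,
Schoof1985, Cohen1993, BernsteinVazirani1997, Watrous2009]
#4 UnitResidueQSolvable (crux) — PELL FACE, GRH-free (card K3): the search problem "input bin(p); if
p is a prime ≡ 1 (4), output bin(t mod p) where (t, u) is the LEAST positive solution of t² − p·u² =
−4 (so ε_p = (t + u√p)/2 is the fundamental unit, of norm −1)" is IsQSolvable (uniform oracle-free
Clifford+T family, success ≥ 2/3, answer as output prefix; no requirement on other inputs). Route:
Hallgren's period finding over ℝ gives R_p = log ε_p to within 2^{−n} in poly(n, log p) with NO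
Riemann hypothesis (GRH enters Hallgren's work only for class-group generators); from such an
approximation the infrastructure yields a compact representation ε_p = Π (α_j/d_j)^{2^{k−j}} of
polynomial bit-length (Buchmann–Thiel–Williams), which is evaluated modulo p𝒪 exactly — the routine
by which the Ankeny–Artin–Chowla verifications obtain t, u mod p after their (classical,
subexponential) regulator step (JacobsonWilliams2008 §9.2 and Ch. 12;
VanderpoortenTerieleWilliams2000). [difficulty: L] (why it might fail: Compact-representation
evaluation mod p must dodge denominators divisible by the RAMIFIED prime p (BTW handle arbitrary m,
but with explicit height bounds the lemma is long); Hallgren's precision/success bookkeeping in the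
strict IsQSolvable model is unbuilt infrastructure.) [Hallgren2007, BuchmannThielWilliams1995,
JacobsonWilliams2008, VanderpoortenTerieleWilliams2000, Cohen1993]
#9 WilsonClassical (support) — ¬X, THE KILL: L_W ∈ BPP — a classical randomized polynomial-time
algorithm for the central factorial ((p−1)/2)! mod p (equivalently, by MatthewsQuarticSign +
Cornacchia + a quartic symbol + a Jacobi symbol, for the sign of the quartic Gauss sum;
equivalently, by ChowlaSignLaw, for t_p mod p together with h(ℚ(√p)) mod 4). Unranked so that no
prover seat is burnt on it; refuters push here. Lines, cheapest first: (a) literature — any printed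
polylog evaluation of Γ_p(1/2) mod p, of Gauss factorials (CosgraveDilcher2011), or of ε_p mod p
avoiding the regulator; (b) the subexponential truth: via Chowla, β_p ≤ (regulator + class number of
ℚ(√p)) = L_p(1/2) under GRH (Buchmann/Vollmer), versus p^{1/2+o(1)} for generic n! mod p
(BostanGaudrySchost2007) — record, not a kill; (c) a theta-reciprocity descent for Σ χ_π(x)e(x/p) in
the style of Hiary's quadratic algorithm (obstruction: complete quartic sums are Fourier-self-dual
at the same modulus). [difficulty: open-problem] [vanDamSeroussi2002, BostanGaudrySchost2007,
CostaGerbiczHarvey2014, CosgraveDilcher2011, Cohen1993]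
#9 ChowlaSignLaw (support) — KISELEV 1948 / CHOWLA 1961 (card K4's named fact, stated over Mathlib's
abstract number fields): for p ≡ 1 (4) prime, K any number field of degree 2 and discriminant p (so
K ≅ ℚ(√p)), h = classNumber K (odd), and (t, u) the least positive solution of t² − p u² = −4: p |
2·((p−1)/2)! − (−1)^{(h+1)/2}·t, i.e. β_p ≡ (−1)^{(h+1)/2}·(t/2) (mod p). Provable from Dirichlet's
formula √p·ε_p^{h} = Π_n (1 − ζ_p^n) (n non-residues) reduced modulo (1 − ζ_p) (JacobsonWilliams2008
eq. (9.7)); printed sign conventions vary (JW's display of Kiselev reads x ≡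
(−1)^{(h−1)/2}((p−1)/2)!), so THIS normalisation was verified numerically for all 211 primes p ≡ 1
(4) below 3000 with independently computed h and t (compute/chowla_check.py: 190 with h ≡ 1, 21 with
h ≡ 3 (mod 4), no failure) and by the card's author below 60000. [difficulty: XL] [Chowla1961,
Mordell1961, AnkenyArtinChowla1952, JacobsonWilliams2008]
#9 ClassBitOfFaces (support) — THE GRH-FREE CLASS BIT (card K4, the crisp deliverable): from
ChowlaSignLaw, MatthewsQuarticSign, WilsonMemBQPOfMatthews and UnitResidueQSolvable, the search
problem "input bin(p), p prime ≡ 1 (4); output h(ℚ(√p)) mod 4" (K any degree-2 number field of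
discriminant p) is IsQSolvable — with no Riemann hypothesis, whereas every printed quantum
class-group algorithm for real quadratic fields (Hallgren2007, Biasse–Song) needs GRH for
generation. Proof = run the L_W decision family (amplified) and the unit-residue family inside one
uniform family, read t mod p and the bit [2β_p < p], recover β_p from the bit and r, and output 1 or
3 according to the sign in 2β_p ≡ ∓t. [difficulty: M] [Chowla1961, Hallgren2007, vanDamSeroussi2002,
Watrous2009]
#9 FairCoin (support) — FAIR COIN (card K5, analytic, open): in every infinite congruence class of
primes p ≡ 1 (4) (p ≡ a mod m), the relative density of L_W is exactly 1/2 — the Wilson bit is not a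
congruence condition on p, even statistically. No automorphic object is known to carry β_p (contrast
order 3: Heath-Brown–Patterson), so this may stay open; the card's data (kit j001469: 19 556 : 19
617 below 10⁶, flat across p mod 16, (a, b) mod 8, χ₄(2), parity type of ε; this session 102 : 109
for the unit bit below 3000) is the evidence. Degenerate classes (m = 0, or gcd(a, m) > 1) are
excluded by the infinitude hypothesis, so the KsNotFrobenian-type vacuity (negatives index) cannot
recur. [difficulty: open-problem] [HeathBrownPatterson1979, Chowla1961, CosgraveDilcher2011]

TWO-LAYER PLAN. Foreseen glued splits (nothing filed now): WilsonMemBQPOfMatthews ⇐ ApproxQFTp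
(uniform approximate F_p in Clifford+T, the
layer KummerSector.KsMemBQP also needs) → ChiStateAndTwist (|χ_π⟩ preparation + Legendre phase +
Hadamard test as one uniform
family with classical wrap) → WilsonMemBQPOfMatthews; UnitResidueQSolvable ⇐ HallgrenRegulator (R_p
to 2^{−n}, GRH-free, as
IsQSolvable) → CompactRepModP (classical: approximation of R_p ↦ t mod p in poly time) →
UnitResidueQSolvable;
ClassBitOfFaces needs no split (composition lemma for IsQSolvable families + arithmetic).

KILL CRITERIA. WilsonClassical proved (L_W ∈ BPP; equivalently a polylog classical algorithm for
((p−1)/2)! mod p, for the quartic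
Gauss-sum sign, or for ε_p mod p plus h mod 4) ⇒ close `refuted:WilsonThesis` — headline news in
computational number theory,
and the earned items (cruxes 2–4, ClassBitOfFaces) survive as theorems. MatthewsQuarticSign refuted
⇒ a transcription slip
(the theorem is Matthews'): restate with the corrected convention, not a kill.
WilsonMemBQPOfMatthews or UnitResidueQSolvable
refuted AS TYPED ⇒ model convention (prefix/one-wire/uniformity): re-type. FairCoin refuted in some
class (a bias law) does
not kill X but makes the bit look Frobenian — refuters should then hunt a congruence description,
which WOULD kill X.
BQP = BPP proved elsewhere moots everything; FACT ∈ BPP does NOT touch this route (no face is known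
to reduce to factoring).

NOT DECOMPOSED YET. The approximate F_p layer and the Hadamard-test wrap (children of crux 3, shared
with KummerSector); Hallgren's algorithm and
the compact-representation lemma as separate statements (children of crux 4); the classical
equivalence web ARCH ≡ WILSON ≡
PELL ⊕ CLASSBIT as FP-reductions (card P2 — needs FP/many-one vocabulary; recorded in
WilsonClassical's text instead); the
GRH certificate face L_W ∈ NP ∩ coNP via Buchmann–Williams short certificates (card P3); the p ≡ 3
(4) twin via Mordell1961
(((p−1)/2)! ≡ (−1)^{(h(−p)+1)/2}, an imaginary class bit — DarkClassGroups territory); the 𝔓-adic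
(Γ_p(1/2)) and Bernoulli
(B_{(p−1)/2}, AAC) faces; the unconditional statement "h(ℚ(√p)) mod 4 ∈ FBQP" (follows from
ClassBitOfFaces once Chowla and
Matthews are Lean theorems — decades away; kept as the implication).

CHEAPEST FALSIFIER. (i) Re-run compute/matthews_check.py and compute/chowla_check.py (this folder;
pure Python, < 2 min to p = 3000): any
mismatch refutes crux 2 / ChowlaSignLaw as transcribed — none found (422/422 pairs, 211/211 primes).
(ii) Literature: a
printed remark that the quartic Gauss-sum sign, ((p−1)/2)! mod p or ε_p mod p is computable in (log
p)^{O(1)} — searched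
(BerndtEvans1981 §4.2: Matthews' formula "requires O(p) operations";
CostaGerbiczHarvey2014/CrandallDilcherPomerance1997 treat
pointwise Wilson quotients as p^{1/2+o(1)}; AAC verifications compute regulators) — none. (iii) kit:
a bias of the Wilson
bit in some class p mod m, m ≤ 64, at 10⁶ (card's j001469 saw none).

NUMBERS. Classical cost of β_p: generic n! mod p in p^{1/2+o(1)} (BostanGaudrySchost2007; Strassen
p^{1/2} log² p); all Wilson
quotients for p ≤ N in N·polylog total (CostaGerbiczHarvey2014, search to 2×10¹³) — amortised only;
via ChowlaSignLaw:
regulator + class number of ℚ(√p), L_p(1/2, O(1)) under GRH, deterministic p^{1/4+o(1)}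
unconditionally (infrastructure).
Quantum: vDS Thm 1 — phase to ±ε in O(ε⁻¹ polylog p), here ε = π/4 suffices (antipodal candidates);
Hallgren2007 — R_p to n
bits in poly(n, log p). Data: Chowla/Kiselev sign law 211/211 (p < 3000, here) and 3016/3016 (p <
60000, card); Matthews'
formula 422/422 pairs (p < 3000, here); unit bit 102:109 (p < 3000), Wilson bit 19 556 : 19 617 (p <
10⁶, card j001469).
Items at open: 9 (1 target, 3 cruxes, 4 support, 1 assembly).

DEFINITION REQUESTS. None needed to state the items: BQP, BPP, IsQSolvable, encodeNat/decodeNat,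
NumberField.classNumber/discr, jacobiSym, ZMod and
the principal complex square root (cpow 1/2) all exist. Named facts a grounder may want as
Literature cites later (NOT in the
route's cone, by design, so the route stays staffable): Matthews1979Quartic (= crux 2 verbatim),
Chowla1961/Kiselev 1948 (=
ChowlaSignLaw verbatim), Hallgren2007 Thm 1.1 (regulator, GRH-free), BuchmannThielWilliams1995
(compact representation ↦
residues mod m). Acquisition requests filed this session: acq-03281 (Chowla1961), acq-03317
(VanderpoortenTerieleWilliams2000),
Williams 1991 doi:10.1016/0012-365x(91)90298-g (spooled).

Novelty: Searches (g2 retriage 2026-08-15, on top of the opener's: lit frontier; zbMATH/arXiv/crossref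
probes; JW2008, IR pp.121–142, vDS02, BerndtEvans1981 READ): `lit search --hybrid "quartic Gauss sum
Matthews sign primary biquadratic character"` (IR 1982 p.138 READ: formula verbatim; Prop 9.10.1
p.134 fixes g² = −(−1)^{(p−1)/4}π√p, so ε ∈ {±i}); `lit read arxiv:quant-ph/0302134` (Jozsa Thm 7
READ: regulator GRH-free); `lit read arxiv:2607.29453` (Tal, 31 Jul 2026, READ pp.4–6, 14, 17, 31 —
surfaced by the card's novelty audit g3, absent from the opener's header); `ledger negatives` (3,
none adjacent). Nearest prior art found: arXiv:2607.29453 (Tal2026ModularFactorials) — n! mod p and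
mod p² in quantum time Õ(q^c + √(p/q)) for q | p−1 by the SAME toolkit (factorial ↔ Jacobi-sum
congruence, Biasse–Song compact reconstruction, van Dam–Seroussi phase estimation Thm 2.7, reduction
of compact representations mod p Lemma 2.3; all GRH-free), its Conj. 6.2 asking only quantum
p^{1/2−ε} for general n; arXiv:quant-ph/0207131 (the primitive and the §8 hardness question);
doi:10.1007/bf01391175 + IR p.138 (Matthews' sign theorem, costed O(p) by BerndtEvans1981);
doi:10.1073/pnas.47.6.878 (Chowla 1961; Kiselev 1948 per JW2008 §9.2); Hallgren2007. Delta: at the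
CENTRAL point n = (p−1)/2, p ≡ 1 (4), Wilson fixes β² = −1 and Matthews 1979 / Chowla 1961 pin the
last bit, so Tal's problem is quantum POLYNOMIAL there by two independent algorithms (Gauss-sum
eigenphase; regulator + compact representat  [refs: 10.1007/bf01391175, 10.1073/pnas.47.6.878, quant-ph/0302134, 2607.29453, quant-ph/0207131, arxiv:quant-ph/0302134, arxiv:2607.29453, doi:10.1007/bf01391175, doi:10.1073/pnas.47.6.878, BerndtEvans1981, Hallgren2007]

Barriers (technique_class: conditional-bridge, quantum-algorithm, number-theory): - technique_class: conditional-bridge, quantum-algorithm, number-theory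
- Literature.Barriers.QuantumAdvantage.SeparationPrerequisites: it does not evade it; X =
WilsonThesis is hypothesis-type (X ∧ WilsonMemBQPOfMatthews ⟹ S ⟹ PP ⊄ BPP, P ≠ PSPACE) and is never
staffed for proof — the bet is a clean, factoring-independent hardness hypothesis (pointwise fast
factorials) plus theorem-grade earned content (L_W ∈ BQP two ways, ClassBitOfFaces).
- Literature.Barriers.QuantumAdvantage.Relativization: L_W ∈ PSPACE, so any proof of X is
non-relativizing — not attempted; the inclusions (WilsonMemBQPOfMatthews, UnitResidueQSolvable) are
explicit oracle-free families and relativize harmlessly, as for Shor/KummerSector.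
- Literature.Barriers.QuantumAdvantage.Algebrization: same status as Relativization (bites only a
proof of X).
- Literature.Barriers.QuantumAdvantage.TotalFunctionSpeedupLimit: consistent — L_W is white-box and
promise-free and its quantisation is ALGEBRAIC (β² = −1: two antipodal eigenphase candidates), so
the query-model limits (D ≤ Q⁴-type, pseudo-deterministic) do not apply.
- Literature.Barriers.QuantumAdvantage.RandomOracleMethod: n/a — no average-case hardness over an
unstructured ensemble is claimed (FairCoin is a distribution statement about the witness, support).
- Literature.Barriers.QuantumAdvantage.NaturalProofs: n/a (uniform classes, no circuit lower bound).
- Literature.Barriers.QuantumAdvantage.PPolyOracles: n/a (no oracle).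
- Literature.Barriers.QuantumA

History (route lifecycle, newest last):
- 2026-08-16T02:18:49Z · AUTO-CRUX: 1 conjecture-grade item(s) promoted to crux (MatthewsQuarticSign) — refuter vetting / tiering apply (operator:999:1362873)
- 2026-08-16T04:14:51Z · AUTO-CRUX (backfill): WilsonThesis — hypotheses of the deciding theorem that nothing in the route derives are cruxes (operator:999:1085951)
- 2026-08-26T14:17:00Z · DORMANT — reconciler: no traction for 6.7 d (last activity item-proof-filed at 2026-08-19T20:56:37Z); parked, not closed — `ledger route dormant route-QuantumAdvantage-Ce (operator:999:1607320)

sub-problem: QuantumAdvantage · status: dormant · opened planner-plancard-QuantumAdvantage-QuantumAdva-46fab044-0 2026-08-15T16:08:59Z · rev 3 · ledger route-QuantumAdvantage-CentralFactorial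
GENERATED by the gate from the ledger (D-0016/17). Provers cite these decls: `theorem foo : Summit.QuantumAdvantage.QuantumAdvantage.Theses.CentralFactorial.<Decl> := …` in Summits/QuantumAdvantage/QuantumAdvantage/Theorems/<Name>.lean.
-/

namespace Summit.QuantumAdvantage.QuantumAdvantage.Theses.CentralFactorial

open scoped BigOperators Topology Manifold Classical MeasureTheory ProbabilityTheory Matrix InnerProductSpace ComplexConjugate ContinuousMap
open Filter Set Function TopologicalSpace MeasureTheory

attribute [summit_statement] _root_.QuantumAdvantage

open Literature.QuantumAdvantage

/-- item stmt-QuantumAdvantage-10304 · crux (kind.auto-crux: conjecture-grade) · rank 0 · open · by planner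
why it might fail: X may be false: via ChowlaSignLaw β_p = ±t/2 mod p, so L_W costs only regulator + h(ℚ(√p)) — L_p(1/2) under GRH, p^{1/4+o(1)} unconditionally — vs p^{1/2+o(1)} for generic n! mod p (BGS07); a regulator-free ε_p mod p or a p-adic Γ_p(1/2) shortcut puts L_W in BPP. No hardness reduction TO L_W known.
sources: BostanGaudrySchost2007, CostaGerbiczHarvey2014, JacobsonWilliams2008, Chowla1961, vanDamSeroussi2002, Tal2026ModularFactorials
[target] X — the central-factorial language L_W = {p prime ≡ 1 (4) : 2·(((p−1)/2)! mod p) < p} is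
not in BPP (hypothesis-type; its negation WilsonClassical is filed as the kill). -/
@[route_item "route-QuantumAdvantage-CentralFactorial", crux]
def WilsonThesis : Prop :=
  Computability.encodingNatBool.toLanguage {p : ℕ | p.Prime ∧ p % 4 = 1 ∧ 2 * (Nat.factorial ((p - 1) / 2) % p) < p} ∉ Literature.Computability.Complexity.BPP

/-- item stmt-QuantumAdvantage-10305 · crux (kind.auto-crux: conjecture-grade) · rank 2 · open · by planner
why it might fail: None statable: Matthews 1979. Transcription risks (ε² = −1 per IR Prop 9.10.1, χ_π vs conjugate, Jacobi symbol at a < 0, cpow branch) discharged ON THE LEAN TERM: a twin written from it with Mathlib conventions agrees for 232/232 pairs (p, π), p < 1500 (g2). Deep to prove in Lean: cost, not doubt.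
sources: Matthews1979Quartic, IrelandRosen1990, BerndtEvans1981, doi:10.1515/crll.1978.297.153
[crux] THE NEEDED PRINTED FACT (Matthews 1979, conjectured in part by Loxton; IR p. 138 form). p ≡ 1
(4) prime, p = a² + b² with π = a + bi PRIMARY (a ≡ 1, b ≡ 0 (4) or a ≡ 3, b ≡ 2 (4); IR Lemma 6 p.
121), r := −a·b⁻¹ mod p (the residue of i mod π), χ_π(x) := i^j when x^{(p−1)/4} ≡ r^j (mod p), β :=
i if ((p−1)/2)! ≡ r (mod p) and −i otherwise. Then Σ_{x<p} χ_π(x) e^{2πix/p} = −β·χ_π(2i)·(2|b| /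
|a|)·√((−1)^{(p−1)/4}(a+bi)√p) with the principal square root (positive real part) and the Jacobi
symbol; here χ_π(2i) = χ(2r). Card item K2's named fact; verified numerically this session for all
422 pairs (p, π), p < 3000 (compute/matthews_check.py; note IR Prop. 9.10.1 gives g² =
−(−1)^{(p−1)/4}√p·π, so ε ∈ {±i}: the p. 138 display "g² = (−1)^{(p−1)/4}π√p" drops a sign but the
final formula is right as printed). [difficulty: XL] -/
@[route_item "route-QuantumAdvantage-CentralFactorial", crux]
def MatthewsQuarticSign : Prop :=
  ∀ (p : ℕ) (a b : ℤ) (r : ZMod p) (χ : ZMod p → ℂ) (β : ℂ), p.Prime → p % 4 = 1 → a ^ 2 + b ^ 2 = (p : ℤ) → ((a % 4 = 1 ∧ b % 4 = 0) ∨ (a % 4 = 3 ∧ b % 4 = 2)) → r = -(a : ZMod p) * (b : ZMod p)⁻¹ → χ = (fun x => if x = 0 then 0 else if x ^ ((p - 1) / 4) = 1 then 1 else if x ^ ((p - 1) / 4) = r then Complex.I else if x ^ ((p - 1) / 4) = -1 then -1 else -Complex.I) → β = (if ((Nat.factorial ((p - 1) / 2) : ℕ) : ZMod p) = r then Complex.I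 else -Complex.I) → ∑ x ∈ Finset.range p, χ (x : ZMod p) * Complex.exp (2 * Real.pi * Complex.I * (x : ℂ) / (p : ℂ)) = -β * χ (2 * r) * ((jacobiSym (2 * |b|) a.natAbs : ℤ) : ℂ) * ((-1 : ℂ) ^ ((p - 1) / 4) * ((a : ℂ) + (b : ℂ) * Complex.I) * ((Real.sqrt p : ℝ) : ℂ)) ^ ((1 : ℂ) / 2)

/-- item stmt-QuantumAdvantage-10306 · support · rank 3 · open · by planner
why it might fail: Not mathematically (antecedent true; vDS phase estimation to ±π/4 separates the two ANTIPODAL candidates). As typed: ONE P-uniform oracle-free Clifford+T family absorbing approximate F_p (p odd), |χ_π⟩ preparation, controlled Legendre phase, classical wrap, error ≤ 1/3 everywhere (as KsMemBQP).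
sources: vanDamSeroussi2002, Tal2026ModularFactorials, Kitaev1995, HalesHallgren2000, Schoof1985, Watrous2009
[crux] Matthews' sign theorem ⟹ L_W ∈ BQP (tree model: P-uniform oracle-free Clifford+T family,
one-wire measurement, error ≤ 1/3). Algorithm on input w: reject non-codewords; p := decode w;
PRIMES ∈ P and p ≡ 1 (4) else reject; r := a square root of −1 mod p (random non-residue to the
power (p−1)/4, or Schoof1985 deterministically), π = a + bi := gcd(p, r − i) in ℤ[i] made primary
(Cornacchia/Euclid), so r ≡ −a/b; classical symbols χ_π(2i) = χ(2r) (one modular exponentiation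
compared with {1, r, −1, −r}) and (2|b|/|a|); quantum (vanDamSeroussi2002 Alg. 1 + Thm 1): prepare
|χ_π⟩ = (p−1)^{−1/2} Σ_{x≠0} χ_π(x)|x⟩ by phase kickback of j(x) ∈ ℤ/4 (no discrete log at fixed
order), apply an approximate F_p then the diagonal Legendre phase |y⟩ ↦ χ_π²(y)|y⟩: |χ_π⟩ is an
eigenvector with eigenvalue g(χ_π)/√p, whose two candidates ±i·(classical unit complex number) are
ANTIPODAL, so O(1) Hadamard tests decide ε with error ≤ 1/10; β := −ε/(χ_π(2i)(2|b|/|a|)) ∈ {±i};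
β_p := r if β = i else p − r; accept iff 2β_p < p. Card item K2. [deps: MatthewsQuarticSign]
[difficulty: L] -/
@[route_item "route-QuantumAdvantage-CentralFactorial", crux]
def WilsonMemBQPOfMatthews : Prop :=
  MatthewsQuarticSign → Computability.encodingNatBool.toLanguage {p : ℕ | p.Prime ∧ p % 4 = 1 ∧ 2 * (Nat.factorial ((p - 1) / 2) % p) < p} ∈ Literature.Computability.Cryptography.BQP

/-- item stmt-QuantumAdvantage-10307 · support · rank 4 · open · by planner
why it might fail: Not mathematically: regulator GRH-free (Hallgren2007 Thm 1.1; Jozsa2003 Thm 7), compact representation of ε_p from R̃ (BTW1995; JW2008 Ch.12, d_i ≤ √p < p), reduction mod p in poly time (Tal2026 Lemma 2.3; JW §12.3). As typed: one uniform Clifford+T family, prefix output, success ≥ 2/3 everywhere.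
sources: Hallgren2007, Jozsa2003, BuchmannThielWilliams1995, JacobsonWilliams2008, Tal2026ModularFactorials, VanderpoortenTerieleWilliams2000
[crux] PELL FACE, GRH-free (card K3): the search problem "input bin(p); if p is a prime ≡ 1 (4),
output bin(t mod p) where (t, u) is the LEAST positive solution of t² − p·u² = −4 (so ε_p = (t +
u√p)/2 is the fundamental unit, of norm −1)" is IsQSolvable (uniform oracle-free Clifford+T family,
success ≥ 2/3, answer as output prefix; no requirement on other inputs). Route: Hallgren's period
finding over ℝ gives R_p = log ε_p to within 2^{−n} in poly(n, log p) with NO Riemann hypothesis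
(GRH enters Hallgren's work only for class-group generators); from such an approximation the
infrastructure yields a compact representation ε_p = Π (α_j/d_j)^{2^{k−j}} of polynomial bit-length
(Buchmann–Thiel–Williams), which is evaluated modulo p𝒪 exactly — the routine by which the
Ankeny–Artin–Chowla verifications obtain t, u mod p after their (classical, subexponential)
regulator step (JacobsonWilliams2008 §9.2 and Ch. 12; VanderpoortenTerieleWilliams2000).
[difficulty: L] -/
@[route_item "route-QuantumAdvantage-CentralFactorial"]
def UnitResidueQSolvable : Prop :=
  Literature.Computability.Cryptography.IsQSolvable fun x => {y | ∀ t u : ℕ, (Computability.decodeNat x).Prime → Computability.decodeNat x % 4 = 1 → t ^ 2 + 4 = Computability.decodeNat x * u ^ 2 → 0 < u → (∀ t' u' : ℕ, t' ^ 2 + 4 = Computability.decodeNat x * u' ^ 2 → 0 < u' → t ≤ t') → Computability.encodeNat (t % Computability.decodeNat x) <+: y}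

/-- item stmt-QuantumAdvantage-10308 · support · rank 9 · open · by planner
sources: vanDamSeroussi2002, BostanGaudrySchost2007, CostaGerbiczHarvey2014, CosgraveDilcher2011, Cohen1993
[support] ¬X, THE KILL: L_W ∈ BPP — a classical randomized polynomial-time algorithm for the central
factorial ((p−1)/2)! mod p (equivalently, by MatthewsQuarticSign + Cornacchia + a quartic symbol + a
Jacobi symbol, for the sign of the quartic Gauss sum; equivalently, by ChowlaSignLaw, for t_p mod p
together with h(ℚ(√p)) mod 4). Unranked so that no prover seat is burnt on it; refuters push here.
Lines, cheapest first: (a) literature — any printed polylog evaluation of Γ_p(1/2) mod p, of Gauss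
factorials (CosgraveDilcher2011), or of ε_p mod p avoiding the regulator; (b) the subexponential
truth: via Chowla, β_p ≤ (regulator + class number of ℚ(√p)) = L_p(1/2) under GRH
(Buchmann/Vollmer), versus p^{1/2+o(1)} for generic n! mod p (BostanGaudrySchost2007) — record, not
a kill; (c) a theta-reciprocity descent for Σ χ_π(x)e(x/p) in the style of Hiary's quadratic
algorithm (obstruction: complete quartic sums are Fourier-self-dual at the same modulus).
[difficulty: open-problem] -/
@[route_item "route-QuantumAdvantage-CentralFactorial"]
def WilsonClassical : Prop :=
  Computability.encodingNatBool.toLanguage {p : ℕ | p.Prime ∧ p % 4 = 1 ∧ 2 * (Nat.factorial ((p - 1) / 2) % p) < p} ∈ Literature.Computability.Complexity.BPP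

/-- item stmt-QuantumAdvantage-10309 · support · rank 9 · closed · proved by Summit.QuantumAdvantage.QuantumAdvantage.Theorems.ChowlaSignLaw.chowlaSignLaw_proof @ a210c43be89c (prover) · by planner
sources: Chowla1961, Mordell1961, AnkenyArtinChowla1952, JacobsonWilliams2008
[support] KISELEV 1948 / CHOWLA 1961 (card K4's named fact, stated over Mathlib's abstract number
fields): for p ≡ 1 (4) prime, K any number field of degree 2 and discriminant p (so K ≅ ℚ(√p)), h =
classNumber K (odd), and (t, u) the least positive solution of t² − p u² = −4: p | 2·((p−1)/2)! −
(−1)^{(h+1)/2}·t, i.e. β_p ≡ (−1)^{(h+1)/2}·(t/2) (mod p). Provable from Dirichlet's formula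
√p·ε_p^{h} = Π_n (1 − ζ_p^n) (n non-residues) reduced modulo (1 − ζ_p) (JacobsonWilliams2008 eq.
(9.7)); printed sign conventions vary (JW's display of Kiselev reads x ≡ (−1)^{(h−1)/2}((p−1)/2)!),
so THIS normalisation was verified numerically for all 211 primes p ≡ 1 (4) below 3000 with
independently computed h and t (compute/chowla_check.py: 190 with h ≡ 1, 21 with h ≡ 3 (mod 4), no
failure) and by the card's author below 60000. [difficulty: XL] -/
@[route_item "route-QuantumAdvantage-CentralFactorial"]
def ChowlaSignLaw : Prop :=
  ∀ (p : ℕ) (K : Type) [Field K] [NumberField K] (t u : ℕ), p.Prime → p % 4 = 1 → Module.finrank ℚ K = 2 → NumberField.discr K = (p : ℤ) → t ^ 2 + 4 = p * u ^ 2 → 0 < u → (∀ t' u' : ℕ, t' ^ 2 + 4 = p * u' ^ 2 → 0 < u' → t ≤ t') → (p : ℤ) ∣ 2 * (Nat.factorial ((p - 1) / 2) : ℤ) - (-1) ^ ((NumberField.classNumber K + 1) / 2) * (t : ℤ)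

-- `ChowlaSignLaw` holds: proved by `Summit.QuantumAdvantage.QuantumAdvantage.Theorems.ChowlaSignLaw.chowlaSignLaw_proof` @ a210c43be89c (its module imports this route file, so no `_holds` link can be stated here).

/-- item stmt-QuantumAdvantage-10310 · support · rank 9 · open · by planner
sources: Chowla1961, Hallgren2007, vanDamSeroussi2002, Watrous2009
[support] THE GRH-FREE CLASS BIT (card K4, the crisp deliverable): from ChowlaSignLaw,
MatthewsQuarticSign, WilsonMemBQPOfMatthews and UnitResidueQSolvable, the search problem "input
bin(p), p prime ≡ 1 (4); output h(ℚ(√p)) mod 4" (K any degree-2 number field of discriminant p) is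
IsQSolvable — with no Riemann hypothesis, whereas every printed quantum class-group algorithm for
real quadratic fields (Hallgren2007, Biasse–Song) needs GRH for generation. Proof = run the L_W
decision family (amplified) and the unit-residue family inside one uniform family, read t mod p and
the bit [2β_p < p], recover β_p from the bit and r, and output 1 or 3 according to the sign in 2β_p
≡ ∓t. [difficulty: M] -/
@[route_item "route-QuantumAdvantage-CentralFactorial"]
def ClassBitOfFaces : Prop :=
  ChowlaSignLaw → MatthewsQuarticSign → WilsonMemBQPOfMatthews → UnitResidueQSolvable → Literature.Computability.Cryptography.IsQSolvable fun x => {y | ∀ (K : Type) [Field K] [NumberField K], (Computability.decodeNat x).Prime → Computability.decodeNat x % 4 = 1 → Module.finrank ℚ K = 2 → NumberField.discr K = (Computability.decodeNat x : ℤ) → Computability.encodeNat (NumberField.classNumber K % 4) <+: y}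

/-- item stmt-QuantumAdvantage-10311 · support · rank 9 · open · by planner
sources: HeathBrownPatterson1979, Chowla1961, CosgraveDilcher2011
[support] FAIR COIN (card K5, analytic, open): in every infinite congruence class of primes p ≡ 1
(4) (p ≡ a mod m), the relative density of L_W is exactly 1/2 — the Wilson bit is not a congruence
condition on p, even statistically. No automorphic object is known to carry β_p (contrast order 3:
Heath-Brown–Patterson), so this may stay open; the card's data (kit j001469: 19 556 : 19 617 below
10⁶, flat across p mod 16, (a, b) mod 8, χ₄(2), parity type of ε; this session 102 : 109 for the
unit bit below 3000) is the evidence. Degenerate classes (m = 0, or gcd(a, m) > 1) are excluded by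
the infinitude hypothesis, so the KsNotFrobenian-type vacuity (negatives index) cannot recur.
[difficulty: open-problem] -/
@[route_item "route-QuantumAdvantage-CentralFactorial"]
def FairCoin : Prop :=
  ∀ m a : ℕ, {p : ℕ | p.Prime ∧ p % 4 = 1 ∧ p % m = a}.Infinite → Filter.Tendsto (fun X : ℕ => (((Finset.range X).filter (fun p => p.Prime ∧ p % 4 = 1 ∧ p % m = a ∧ 2 * (Nat.factorial ((p - 1) / 2) % p) < p)).card : ℝ) / (((Finset.range X).filter (fun p => p.Prime ∧ p % 4 = 1 ∧ p % m = a)).card : ℝ)) Filter.atTop (nhds (1 / 2 : ℝ))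

/-- item stmt-QuantumAdvantage-10312 · assembly · rank 1 · closed · proved by Summit.QuantumAdvantage.QuantumAdvantage.Theorems.CentralFactorial.Assembly_proof @ 225e34940813 (prover) · by planner
sources: vanDamSeroussi2002, BernsteinVazirani1997
[assembly] MatthewsQuarticSign → WilsonMemBQPOfMatthews → WilsonThesis → QuantumAdvantage
(∃-introduction). -/
@[route_item "route-QuantumAdvantage-CentralFactorial"]
def Assembly : Prop :=
  MatthewsQuarticSign → WilsonMemBQPOfMatthews → WilsonThesis → QuantumAdvantage

-- `Assembly` holds: proved by `Summit.QuantumAdvantage.QuantumAdvantage.Theorems.CentralFactorial.Assembly_proof` @ 225e34940813 (its module imports this route file, so no `_holds` link can be stated here).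

/-! D-0027 §2.1 — DECIDING THEOREM (planner-authored via `route open/edit --closes-file`; by planner-plancard-QuantumAdvantage-QuantumAdva-46fab044-0 2026-08-15T16:09:01Z):
its hypotheses are this route's items and its conclusion the sub-problem Statement (glue_lint), and it elaborates with this file. -/

@[closes "route-QuantumAdvantage-CentralFactorial"] theorem closes (h₁ : MatthewsQuarticSign) (h₂ : WilsonMemBQPOfMatthews) (h₃ : WilsonThesis) : QuantumAdvantage :=
  ⟨_, h₂ h₁, h₃⟩

end Summit.QuantumAdvantage.QuantumAdvantage.Theses.CentralFactorial
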